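import Summits.QuantumFields.BalabanUV.T4Continuum.Support.NE3SmoothLiftFlat
import HarnessLib

/-!
# T⁴ programme, node NE3 — route Π, row Π-R («SMOOTH RIGHT INVERSE», D-ne3p1-g24-1 §6), file Π-R♭-4a: THE SMOOTH LIFT VANISHES ON EVERY
# BLOCK FACE; its SUP and ℓ² letters with constants as numbers

NE3 (node U1b) formalisation swarm, leaf seat `b2b-balaban-t4-ne3-formalise-leaf-01` (gen 7); owner GO ρ-g24-3 (4) (`HOME/CLAIMS.log` l.21552: «display,
per file, the four letters (ℓ², curlSq, Σ|curl|, sup) with constants as numbers»).  THIS FILE: the first two letters of the LIFT `smoothLift M φ`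
(Π-R♭-2 `NE3SmoothLiftFlat`) and the face-vanishing that drives the curl letters (Π-R♭-4b): **`‖smoothLift M φ z κ‖ ≤ (24·8^{d−1}∕M)·‖φ (blk M z) κ‖`**
and **`Σ_{y∈periodBox(M·N)} Σ_κ ‖smoothLift M φ y κ‖² ≤ (24·8^{d−1})²·M^{d−2}·Σ_{z∈periodBox N} Σ_κ ‖φ z κ‖²`** (`M ≥ 2`): amplitude `O(φ∕M)`, NO `∇φ`.
At `d = 4`: `24·8³ = 12 288`, squared `1.5e8` — crude (the true profile ratio is ≈ `72·1.5^{d−1}`), honest, k-FREE.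

CONTENT ([folklore]; 0 sorry; 0 def): §1 `liftNorm_ge` (`liftNorm d M ≥ M²∕(24·8^{d−1})`: K5a `le_tentSum` pattern + `(M−1)(M+1)(M+2) ≥ M³∕2`), `tperp_nonneg`,
`tperp_le_one`; §2 face-vanishing `smoothLift_of_res_self_eq_zero` (longitudinal near face, `lprof_zero`) and `smoothLift_of_res_ne_eq_zero` (any transverse
face, `fac_eq_zero_of_res_eq_zero`); §3 **`norm_smoothLift_le`**, **`sum_normSq_smoothLift_le`**.

HONEST FRAMING.  Flat kinematics of OUR lift; SHAPE `SmoothLift` NOT yet discharged (curl letters Π-R♭-4b, curved W Π-R-W); (P♮)_W, T-E_w and **NE3 are NOT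
proved**; spine PROVED 0∕9; finite T⁴ rung (B)+1 — NOT infinite volume, NOT mass gap, NOT `BetaPertH`, NOT Clay.  PLACEMENT: `Summits/QuantumFields/BalabanUV/`.
HONEST DEPENDENCY (cell page 1): continuum YM on T⁴ ⇐ BetaPertH ∧ nine spine estimates (0/9 proved); BetaPertH ⇐ (D1) ∧ (D4) ∧ CAP+tail; G-an2-4 gates
asym, D1 and NE2/3/4.
-/

set_option autoImplicit false

open scoped BigOperators Matrix.Norms.L2Operator
open Finset

namespace Summit.QuantumFields.BalabanUV.T4Continuum.NE3SmoothLiftBounds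

open Literature.MathematicalPhysics.QuantumFieldTheory.Balaban1983to89
open B7Prop1Explicit B7Prop2Explicit
open T4AveragingDeficitWallBoundary (periodBox mem_periodBox card_periodBox)
open SmoothRefineBlocks (blk res res_nonneg res_lt)
open NE3CoarseInterpolant (blk_block)
open NE3BlockLineAverage (sum_periodBox_blocks)
open NE3TentBump (fac fac_nonneg fac_le_one fac_eq_zero_of_res_eq_zero)
open NE3SmoothLiftProfile (lprof lprof_zero abs_lprof_le)
open NE3SmoothLiftFlat (tperp liftNorm smoothLift liftNorm_pos)

noncomputable section

variable {d : ℕ} {n : Type*}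

/-! ## §1 The normalisation from below; the transverse bump in `[0,1]` -/

/-- `liftNorm d M ≥ M²∕(24·8^{d−1})` for `M ≥ 2`. [folklore] -/
theorem liftNorm_ge {M : ℕ} (hM : 2 ≤ M) (d : ℕ) (hd : 1 ≤ d) :
    (M : ℝ) ^ 2 / (24 * (8 : ℝ) ^ (d - 1)) ≤ liftNorm d M := by
  have hM2 : (2 : ℝ) ≤ M := by exact_mod_cast hM
  have hM0 : (0 : ℝ) < M := by linarith
  unfold liftNorm
  -- `((M²−1)/(6M))^{d−1} ≥ (M/8)^{d−1}` and `(M−1)(M+1)(M+2)/12 ≥ M³/24`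
  have h1 : ((M : ℝ) / 8) ^ (d - 1) ≤ ((((M : ℝ)) ^ 2 - 1) / (6 * M)) ^ (d - 1) := by
    refine pow_le_pow_left₀ (by positivity) ?_ _
    rw [div_le_div_iff₀ (by norm_num) (by positivity)]
    nlinarith
  have h2 : (M : ℝ) ^ 3 / 24 ≤ (((M : ℝ)) - 1) * ((M : ℝ) + 1) * ((M : ℝ) + 2) / 12 := by
    rw [div_le_div_iff₀ (by norm_num) (by norm_num)]
    nlinarith [mul_nonneg (mul_nonneg hM0.le hM0.le) (by linarith : (0 : ℝ) ≤ (M : ℝ) - 2)]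
  have hMd : (M : ℝ) ^ d = (M : ℝ) ^ (d - 1) * M := by rw [← pow_succ, Nat.sub_add_cancel hd]
  have h3 : ((M : ℝ) ^ d)⁻¹ * ((M : ℝ) / 8) ^ (d - 1) * ((M : ℝ) ^ 3 / 24) = (M : ℝ) ^ 2 / (24 * (8 : ℝ) ^ (d - 1)) := by
    have hM8 : ((M : ℝ) ^ (d - 1)) ≠ 0 := by positivity
    rw [hMd, div_pow]
    field_simp
  have hq1 : (0 : ℝ) ≤ ((((M : ℝ)) ^ 2 - 1) / (6 * M)) ^ (d - 1) := by
    have : (0 : ℝ) ≤ ((M : ℝ)) ^ 2 - 1 := by nlinarith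
    positivity
  have hq2 : (0 : ℝ) ≤ (M : ℝ) ^ 3 / 24 := by positivity
  calc (M : ℝ) ^ 2 / (24 * (8 : ℝ) ^ (d - 1)) = ((M : ℝ) ^ d)⁻¹ * ((M : ℝ) / 8) ^ (d - 1) * ((M : ℝ) ^ 3 / 24) := h3.symm
    _ ≤ ((M : ℝ) ^ d)⁻¹ * ((((M : ℝ)) ^ 2 - 1) / (6 * M)) ^ (d - 1) * ((M : ℝ) ^ 3 / 24) :=
        mul_le_mul_of_nonneg_right (mul_le_mul_of_nonneg_left h1 (by positivity)) hq2
    _ ≤ ((M : ℝ) ^ d)⁻¹ * ((((M : ℝ)) ^ 2 - 1) / (6 * M)) ^ (d - 1) * ((((M : ℝ)) - 1) * ((M : ℝ) + 1) * ((M : ℝ) + 2) / 12) :=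
        mul_le_mul_of_nonneg_left h2 (mul_nonneg (by positivity) hq1)

/-- `0 ≤ tperp ≤ 1` (`M ≥ 1`). [folklore] -/
theorem tperp_nonneg {M : ℕ} (hM : 1 ≤ M) (κ : Fin d) (z : Site d) : 0 ≤ tperp M κ z :=
  Finset.prod_nonneg fun j _ => fac_nonneg hM z j

/-- `tperp ≤ 1` (`M ≥ 1`). [folklore] -/
theorem tperp_le_one {M : ℕ} (hM : 1 ≤ M) (κ : Fin d) (z : Site d) : tperp M κ z ≤ 1 :=
  Finset.prod_le_one (fun j _ => fac_nonneg hM z j) fun j _ => fac_le_one hM z j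

/-! ## §2 Face-vanishing -/

/-- **THE LIFT VANISHES ON THE NEAR LONGITUDINAL FACE** (`ρ_κ(z) = 0`). [folklore] -/
theorem smoothLift_of_res_self_eq_zero (M : ℕ) (φ : Site d → Fin d → Matrix n n ℂ) {z : Site d} {κ : Fin d} (h : res M z κ = 0) :
    smoothLift M φ z κ = 0 := by
  unfold smoothLift; rw [h, lprof_zero]; simp

/-- **THE LIFT VANISHES ON EVERY TRANSVERSE FACE** (`ρ_j(z) = 0` for some `j ≠ κ`). [folklore] -/
theorem smoothLift_of_res_ne_eq_zero (M : ℕ) (φ : Site d → Fin d → Matrix n n ℂ) {z : Site d} {κ j : Fin d} (hj : j ≠ κ)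
    (h : res M z j = 0) : smoothLift M φ z κ = 0 := by
  have ht : tperp M κ z = 0 := Finset.prod_eq_zero (Finset.mem_erase.mpr ⟨hj, Finset.mem_univ j⟩) (fac_eq_zero_of_res_eq_zero h)
  unfold smoothLift; rw [ht]; simp

/-! ## §3 The sup and ℓ² letters -/

/-- **SUP LETTER**: `‖smoothLift M φ z κ‖ ≤ (24·8^{d−1}∕M)·‖φ (blk M z) κ‖` (`M ≥ 2`, `d ≥ 1`). [folklore] -/
theorem norm_smoothLift_le [Fintype n] [DecidableEq n] {M : ℕ} (hM : 2 ≤ M) (hd : 1 ≤ d) (φ : Site d → Fin d → Matrix n n ℂ)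
    (z : Site d) (κ : Fin d) :
    ‖smoothLift M φ z κ‖ ≤ (24 * (8 : ℝ) ^ (d - 1) / M) * ‖φ (blk M z) κ‖ := by
  have hM1 : 1 ≤ M := by omega
  have hM0 : (0 : ℝ) < M := by exact_mod_cast (by omega : 0 < M)
  have hc := liftNorm_pos hM d
  have hcge := liftNorm_ge hM d hd
  have hg : |lprof M (res M z κ)| ≤ M := abs_lprof_le hM1 (res_nonneg hM1 z κ) (res_lt hM1 z κ).le
  have ht0 := tperp_nonneg hM1 κ z
  have ht1 := tperp_le_one hM1 κ z
  unfold smoothLift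
  rw [norm_smul, Real.norm_eq_abs, abs_mul, abs_mul, abs_of_pos (inv_pos.mpr hc), abs_of_nonneg ht0]
  refine mul_le_mul_of_nonneg_right ?_ (norm_nonneg _)
  -- `c⁻¹·|g|·t ≤ c⁻¹·M ≤ 24·8^{d−1}/M`
  have h1 : (liftNorm d M)⁻¹ * (|lprof M (res M z κ)| * tperp M κ z) ≤ (liftNorm d M)⁻¹ * M := by
    refine mul_le_mul_of_nonneg_left ?_ (inv_nonneg.mpr hc.le)
    calc |lprof M (res M z κ)| * tperp M κ z ≤ M * 1 := mul_le_mul hg ht1 ht0 hM0.le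
      _ = M := mul_one _
  refine h1.trans ?_
  rw [inv_mul_le_iff₀ hc]
  have h8 : (0 : ℝ) < 24 * (8 : ℝ) ^ (d - 1) := by positivity
  calc (M : ℝ) = (M : ℝ) ^ 2 / (24 * (8 : ℝ) ^ (d - 1)) * (24 * (8 : ℝ) ^ (d - 1) / M) := by field_simp
    _ ≤ liftNorm d M * (24 * (8 : ℝ) ^ (d - 1) / M) := mul_le_mul_of_nonneg_right hcge (by positivity)

/-- **ℓ² LETTER**: `Σ_{y∈periodBox(M·N)} Σ_κ ‖smoothLift M φ y κ‖² ≤ (24·8^{d−1})²·M^{d−2}·Σ_{z∈periodBox N} Σ_κ ‖φ z κ‖²` (`M ≥ 2`, `d ≥ 1`, any `N`). [folklore] -/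
theorem sum_normSq_smoothLift_le [Fintype n] [DecidableEq n] {M : ℕ} (hM : 2 ≤ M) (hd : 1 ≤ d) (N : ℕ) (φ : Site d → Fin d → Matrix n n ℂ) :
    ∑ y ∈ periodBox (d := d) (M * N), ∑ κ : Fin d, ‖smoothLift M φ y κ‖ ^ 2
      ≤ (24 * (8 : ℝ) ^ (d - 1)) ^ 2 * ((M : ℝ) ^ d / (M : ℝ) ^ 2) * ∑ z ∈ periodBox (d := d) N, ∑ κ : Fin d, ‖φ z κ‖ ^ 2 := by
  have hM1 : 1 ≤ M := by omega
  have hM0 : (0 : ℝ) < M := by exact_mod_cast (by omega : 0 < M)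
  have hpt : ∀ (y : Site d) (κ : Fin d), ‖smoothLift M φ y κ‖ ^ 2 ≤ (24 * (8 : ℝ) ^ (d - 1) / M) ^ 2 * ‖φ (blk M y) κ‖ ^ 2 := by
    intro y κ
    rw [← mul_pow]
    exact pow_le_pow_left₀ (norm_nonneg _) (norm_smoothLift_le hM hd φ y κ) 2
  calc ∑ y ∈ periodBox (d := d) (M * N), ∑ κ : Fin d, ‖smoothLift M φ y κ‖ ^ 2
      ≤ ∑ y ∈ periodBox (d := d) (M * N), ∑ κ : Fin d, (24 * (8 : ℝ) ^ (d - 1) / M) ^ 2 * ‖φ (blk M y) κ‖ ^ 2 :=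
        Finset.sum_le_sum fun y _ => Finset.sum_le_sum fun κ _ => hpt y κ
    _ = (M : ℝ) ^ d * ∑ z ∈ periodBox (d := d) N, ∑ κ : Fin d, (24 * (8 : ℝ) ^ (d - 1) / M) ^ 2 * ‖φ z κ‖ ^ 2 := by
        rw [← sum_periodBox_blocks M N hM1, Finset.mul_sum]
        refine Finset.sum_congr rfl fun z _ => ?_
        rw [Finset.sum_congr rfl fun v hv => by rw [blk_block hM1 z hv], Finset.sum_const, card_periodBox, nsmul_eq_mul, Nat.cast_pow]
    _ = _ := by
        rw [Finset.mul_sum, Finset.mul_sum]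
        refine Finset.sum_congr rfl fun z _ => ?_
        rw [Finset.mul_sum, Finset.mul_sum]
        refine Finset.sum_congr rfl fun κ _ => ?_
        field_simp

end

end Summit.QuantumFields.BalabanUV.T4Continuum.NE3SmoothLiftBounds
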